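import Literature.Computability.Cryptography.AffineHashStrings
import Literature.Computability.Complexity.HashBricks
import HarnessLib

/-!
# Affine hashing on bit strings is polynomial time (the `FP` brick `hashFn`)

`AffineHashStrings.lean` fixes the string-keyed affine hash family as a bit-string function,
`hashStr m k σ x = [rowParity σ m (x ↾ m) j]_{j < k}` (row `j` of the key `σ` at bits
`j(m+1) … j(m+1)+m-1`, offset bit `j(m+1)+m`, the layout of `Stockmeyer.coinHash`; on `x ∈ {0,1}^m`
it is the encoded `𝔽₂`-hash `A_σ x + b_σ`, `hashStr_toList`). This file proves that it is
**efficiently computable** — Liu–Pass 2020, Appendix, Lemma [car79]: "there exists a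
polynomial-time computable function `H : {0,1}ⁿ × {0,1}^{n^c} → {0,1}ⁿ` such that … is a universal
hash family" — in the tree's TM2 sense, as a pipeline of existing `FP` bricks with one clocked
loop over the `k` rows (no new machine; the bricks are those of `HashBricks.lean`, written for this
very layout: `andParityFn` for the inner products, `umulFn` for the offsets `j(m+1)`,
`headBitFn ∘ dropFn` for the offset bit):

* `AffineProg.hashFn ⟨⟨1ᵐ, 1ᵏ⟩, ⟨σ, x⟩⟩ = hashStr m k σ x` (`hashFn_boolPair`), `hashFn_mem_FP`.

## References

* J. L. Carter, M. N. Wegman, *Universal classes of hash functions*, JCSS 18 (1979) 143–154.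
* Y. Liu, R. Pass, *On one-way functions and Kolmogorov complexity*, FOCS 2020
  (arXiv:2009.11514), Appendix, Lemma [car79].
* S. Arora, B. Barak, *Computational Complexity: A Modern Approach*, CUP 2009, §1.3, §1.4.1, §8.2.2.
-/

namespace Literature.Computability.Cryptography

namespace AffineProg

open _root_.Computability Polynomial Complexity Complexity.Brick Complexity.Plumb Complexity.OracleCompose
  Complexity.HashBricks Complexity.Stockmeyer AffineStr

/-- `andParityFn` on every word: the parity of the bitwise `AND` of its two projections. [folklore] -/
theorem andParityFn_apply (z : List Bool) :
    andParityFn z = [decide (Odd (((fstF z).zipWith (· && ·) (sndF z)).count true))] := by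
  have h := iterate_parRound (sndF z) (sndF z).length (fstF z) (sndF z) false
  simp only [andParityFn, parInit, Function.comp_apply, fanoutFn_apply, boolUnpair_boolPair, eval_X, h,
    parModel_parity, Bool.false_xor, sndF_boolPair]

/-- `headD` after `drop` reads a position. [folklore] -/
theorem headD_drop (l : List Bool) (n : ℕ) : (l.drop n).headD false = l.getD n false := by
  induction l generalizing n with
  | nil => simp
  | cons b l ih =>
    cases n with
    | zero => simp
    | succ n => simp only [List.drop_succ_cons, List.getD_cons_succ, ih]

/-- `1 :: 1ᵃ = 1ᵃ⁺¹`. [folklore] -/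
theorem true_cons_ones (a : ℕ) : true :: ones a = ones (a + 1) := rfl

/-! #### The state `⟨1ᵏ, ⟨1ᵐ, ⟨σ, ⟨x, ⟨1ʲ, acc⟩⟩⟩⟩⟩` and one round -/

/-- The loop state. [folklore] -/
def hState (k m : ℕ) (σ x : List Bool) (j : ℕ) (acc : List Bool) : List Bool :=
  boolPair (ones k) (boolPair (ones m) (boolPair σ (boolPair x (boolPair (ones j) acc))))

/-- The row offset `1^{j(m+1)}` (`Stockmeyer.rowStart`). [folklore] -/
noncomputable def rsF : List Bool → List Bool := umulFn ∘ fanoutFn (nthF 4) (List.cons true ∘ nthF 1)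
/-- The key from row `j` on: `σ ⇂ j(m+1)`. [folklore] -/
noncomputable def rowF : List Bool → List Bool := dropFn ∘ fanoutFn rsF (nthF 2)
/-- The point, cut to `m` bits: `x ↾ m`. [folklore] -/
noncomputable def yF : List Bool → List Bool := takeFn ∘ fanoutFn (nthF 1) (nthF 3)
/-- The inner-product bit `[parity((σ ⇂ j(m+1)) ∧ (x ↾ m))]`. [folklore] -/
noncomputable def parF : List Bool → List Bool := andParityFn ∘ fanoutFn rowF yF
/-- The offset bit `[σ[j(m+1) + m]]`. [folklore] -/
noncomputable def shiftF : List Bool → List Bool :=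
  headBitFn ∘ dropFn ∘ fanoutFn (concatFn ∘ fanoutFn rsF (nthF 1)) (nthF 2)
/-- The output bit of the round (`Stockmeyer.rowParity`). [folklore] -/
noncomputable def bitF : List Bool → List Bool := xorFn parF shiftF
/-- **One round**: append bit `j`, advance `j`. [folklore] -/
noncomputable def roundF : List Bool → List Bool :=
  fanoutFn fstF (fanoutFn (nthF 1) (fanoutFn (nthF 2) (fanoutFn (nthF 3)
    (fanoutFn (List.cons true ∘ nthF 4) (concatFn ∘ fanoutFn (sndPow 4) bitF)))))
/-- The initial state from the input `⟨⟨1ᵐ, 1ᵏ⟩, ⟨σ, x⟩⟩`. [folklore] -/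
noncomputable def initF : List Bool → List Bool :=
  fanoutFn (sndF ∘ fstF) (fanoutFn (fstF ∘ fstF) (fanoutFn (fstF ∘ sndF) (fanoutFn (sndF ∘ sndF)
    (fanoutFn (fun _ => []) (fun _ => [])))))
/-- **`hashFn ⟨⟨1ᵐ, 1ᵏ⟩, ⟨σ, x⟩⟩ = hashStr m k σ x`**: `k` rounds from the initial state, then the
accumulator. [Y. Liu, R. Pass, FOCS 2020, Appendix, Lemma [car79]; Arora–Barak 2009, §8.2.2] [folklore] -/
noncomputable def hashFn : List Bool → List Bool :=
  sndPow 4 ∘ (fun S => roundF^[(X : Polynomial ℕ).eval (boolUnpair S).1.length] S) ∘ initF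

/-! #### Values -/

/-- The parity bit is a single bit on every word. [folklore] -/
theorem parF_apply (S : List Bool) : parF S = [decide (Odd (((rowF S).zipWith (· && ·) (yF S)).count true))] := by
  simp only [parF, Function.comp_apply, andParityFn_apply, fanoutFn_apply, fstF_boolPair, sndF_boolPair]

/-- The offset bit is a single bit on every word. [folklore] -/
theorem shiftF_apply (S : List Bool) : shiftF S = [(nthF 2 S).getD ((rsF S).length + (nthF 1 S).length) false] := by
  simp only [shiftF, Function.comp_apply, fanoutFn_apply, concatFn_boolPair, dropFn_boolPair, headBitFn_apply,
    List.length_append, headD_drop]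

/-- The round's bit on every word. [folklore] -/
theorem bitF_apply (S : List Bool) :
    bitF S = [xor (decide (Odd (((rowF S).zipWith (· && ·) (yF S)).count true)))
      ((nthF 2 S).getD ((rsF S).length + (nthF 1 S).length) false)] :=
  xorFn_apply (parF_apply S) (shiftF_apply S)

/-- The row offset on a state. [folklore] -/
theorem rsF_hState (k m : ℕ) (σ x : List Bool) (j : ℕ) (acc : List Bool) :
    rsF (hState k m σ x j acc) = ones (rowStart m j) := by
  simp only [rsF, hState, Function.comp_apply, fanoutFn_apply, nthF_succ_boolPair, nthF_zero_boolPair,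
    true_cons_ones, umulFn_boolPair, rowStart]

/-- **One round on a state**: it appends `rowParity σ m (x ↾ m) j`. [folklore] -/
theorem roundF_hState (k m : ℕ) (σ x : List Bool) (j : ℕ) (acc : List Bool) :
    roundF (hState k m σ x j acc) = hState k m σ x (j + 1) (acc ++ [rowParity σ m (x.take m) j]) := by
  have hrs := rsF_hState k m σ x j acc
  have hb := bitF_apply (hState k m σ x j acc)
  simp only [rowF, yF, Function.comp_apply, fanoutFn_apply, hrs, dropFn_boolPair, takeFn_boolPair, List.length_replicate]
    at hb
  simp only [hState, nthF_succ_boolPair, nthF_zero_boolPair, List.length_replicate] at hb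
  simp only [roundF, fanoutFn_apply, Function.comp_apply, hState, fstF_boolPair, nthF_succ_boolPair, nthF_zero_boolPair,
    sndPow_succ_boolPair, sndPow_zero_boolPair, concatFn_boolPair, hb, rowParity, coinBit, true_cons_ones]

/-- The rounds fill in the bits one by one. [folklore] -/
theorem iterate_roundF (k m : ℕ) (σ x : List Bool) : ∀ j : ℕ,
    roundF^[j] (hState k m σ x 0 []) = hState k m σ x j ((List.range j).map (rowParity σ m (x.take m)))
  | 0 => by simp [hState]
  | j + 1 => by
    rw [Function.iterate_succ_apply', iterate_roundF k m σ x j, roundF_hState, List.range_succ, List.map_append,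
      List.map_singleton]

/-- **`hashFn ⟨⟨1ᵐ, 1ᵏ⟩, ⟨σ, x⟩⟩ = hashStr m k σ x`.** [folklore] -/
theorem hashFn_boolPair (m k : ℕ) (σ x : List Bool) :
    hashFn (boolPair (boolPair (ones m) (ones k)) (boolPair σ x)) = hashStr m k σ x := by
  have hinit : initF (boolPair (boolPair (ones m) (ones k)) (boolPair σ x)) = hState k m σ x 0 [] := by
    simp [initF, hState, fstF, sndF]
  have h := iterate_roundF k m σ x k
  simp only [hashFn, Function.comp_apply, hinit]
  rw [show (boolUnpair (hState k m σ x 0 [])).1.length = k by simp [hState], eval_X, h, hashStr]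
  simp [hState, sndPow]

/-! #### `FP` membership -/

/-- `rsF ∈ FP`. [folklore] -/
theorem rsF_mem_FP : rsF ∈ FP :=
  comp_mem_FP umulFn_mem_FP (fanoutFn_mem_FP (nthF_mem_FP 4) (comp_mem_FP (cons_mem_FP true) (nthF_mem_FP 1)))
/-- `rowF ∈ FP`. [folklore] -/
theorem rowF_mem_FP : rowF ∈ FP := comp_mem_FP dropFn_mem_FP (fanoutFn_mem_FP rsF_mem_FP (nthF_mem_FP 2))
/-- `yF ∈ FP`. [folklore] -/
theorem yF_mem_FP : yF ∈ FP := comp_mem_FP takeFn_mem_FP (fanoutFn_mem_FP (nthF_mem_FP 1) (nthF_mem_FP 3))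
/-- `parF ∈ FP`. [folklore] -/
theorem parF_mem_FP : parF ∈ FP := comp_mem_FP andParityFn_mem_FP (fanoutFn_mem_FP rowF_mem_FP yF_mem_FP)
/-- `shiftF ∈ FP`. [folklore] -/
theorem shiftF_mem_FP : shiftF ∈ FP :=
  comp_mem_FP headBitFn_mem_FP (comp_mem_FP dropFn_mem_FP (fanoutFn_mem_FP
    (comp_mem_FP concatFn_mem_FP (fanoutFn_mem_FP rsF_mem_FP (nthF_mem_FP 1))) (nthF_mem_FP 2)))
/-- `bitF ∈ FP`. [folklore] -/
theorem bitF_mem_FP : bitF ∈ FP := xorFn_mem_FP parF_mem_FP shiftF_mem_FP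
/-- `roundF ∈ FP`. [folklore] -/
theorem roundF_mem_FP : roundF ∈ FP :=
  fanoutFn_mem_FP fstF_mem_FP (fanoutFn_mem_FP (nthF_mem_FP 1) (fanoutFn_mem_FP (nthF_mem_FP 2) (fanoutFn_mem_FP (nthF_mem_FP 3)
    (fanoutFn_mem_FP (comp_mem_FP (cons_mem_FP true) (nthF_mem_FP 4)) (comp_mem_FP concatFn_mem_FP
      (fanoutFn_mem_FP (sndPow_mem_FP 4) bitF_mem_FP))))))
/-- `initF ∈ FP`. [folklore] -/
theorem initF_mem_FP : initF ∈ FP :=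
  fanoutFn_mem_FP (comp_mem_FP sndF_mem_FP fstF_mem_FP) (fanoutFn_mem_FP (comp_mem_FP fstF_mem_FP fstF_mem_FP)
    (fanoutFn_mem_FP (comp_mem_FP fstF_mem_FP sndF_mem_FP) (fanoutFn_mem_FP (comp_mem_FP sndF_mem_FP sndF_mem_FP)
      (fanoutFn_mem_FP (const_mem_FP _) (const_mem_FP _)))))

/-- The round's bit is one bit long on every word. [folklore] -/
theorem length_bitF (S : List Bool) : (bitF S).length = 1 := by rw [bitF_apply]; rfl

/-- **Additive growth of the round on every word** (`+13`: two symbols for the counter, one for the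
new bit, ten for re-pairing five projections). [folklore] -/
theorem length_roundF_le (S : List Bool) : (roundF S).length ≤ S.length + 13 := by
  have h0 := length_fstF_sndF_le S
  have h1 := length_fstF_sndF_le (sndF S)
  have h2 := length_fstF_sndF_le (sndF (sndF S))
  have h3 := length_fstF_sndF_le (sndF (sndF (sndF S)))
  have h4 := length_fstF_sndF_le (sndF (sndF (sndF (sndF S))))
  have hb := length_bitF S
  have e1 : nthF 1 S = fstF (sndF S) := rfl
  have e2 : nthF 2 S = fstF (sndF (sndF S)) := rfl
  have e3 : nthF 3 S = fstF (sndF (sndF (sndF S))) := rfl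
  have e4 : nthF 4 S = fstF (sndF (sndF (sndF (sndF S)))) := rfl
  have e5 : sndPow 4 S = sndF (sndF (sndF (sndF (sndF S)))) := rfl
  simp only [roundF, fanoutFn_apply, Function.comp_apply, length_boolPair, List.length_cons, concatFn_boolPair,
    List.length_append, hb, e1, e2, e3, e4, e5]
  omega

/-- **`hashFn ∈ FP`**: affine hashing keyed by strings is polynomial time. [Y. Liu, R. Pass, FOCS
2020, Appendix, Lemma [car79]; Arora–Barak 2009, §1.3–1.4] [cite: LiuPassFOCS2020, Lemma 5.3 (proof, Appendix: Lemma car79)] -/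
theorem hashFn_mem_FP : hashFn ∈ FP :=
  comp_mem_FP (sndPow_mem_FP 4) (comp_mem_FP (iterate_mem_FP roundF_mem_FP 13 length_roundF_le X) initF_mem_FP)

end AffineProg

end Literature.Computability.Cryptography
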